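import Literature.Analysis.OperatorTheory.YangMillsMatrixModelAgmonBase
import Literature.Analysis.OperatorTheory.YangMillsMatrixModelWeakSolutions
import Mathlib.Analysis.Distribution.TemperateGrowth
import Mathlib.Analysis.Calculus.FDeriv.Symmetric
import HarnessLib

/-!
# Exponential `L²` decay of ALL derivatives of an eigenfunction of Lüscher's matrix-model Hamiltonian

Topic `Literature/Analysis/OperatorTheory`; decay step (N5, higher derivatives) of the formalisation of the named fact
`LuscherHamiltonianEigenfunctions` (AL1), after `YangMillsMatrixModelAgmonBase.lean` (`∫e^{2a⟨x⟩}f² < ∞`) and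
`YangMillsMatrixModelAgmonCaccioppoli.lean` (propagation of weighted decay from `F`, `𝔥F − EF` to `∂_pF`).

For a smooth `L²` solution `f` of `𝔥f = Ef` on `ℝ⁹` (`𝔥 = −½Δ + V`, `V` Lüscher's quartic potential) and every coordinate word
`w = [p₁, …, p_m]`, the iterated partial derivative `∂_w f = ∂_{p₁} ⋯ ∂_{p_m} f` (Lean: `w.foldr pderiv f`) satisfies
`∫ e^{2a⟨x⟩} (∂_w f)² < ∞` for every `a ≥ 0` (`integrable_exp_sq_mul_foldr_pderiv_sq`).  Mechanism (Agmon 1982, Cor. 4.5 /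
Gilbarg–Trudinger interior bootstrap, in weighted-energy form): differentiating the equation,
`𝔥(∂_w f) = E ∂_w f + r_w` with `r_w = Σ_i c_i · ∂_{u_i} f`, `|u_i| < |w|`, `c_i` derivatives of `V` (functions of temperate growth —
Mathlib's `Function.HasTemperateGrowth`, closed under `∂_p`, with `V` itself of temperate growth as a polynomial); temperate factors
preserve the decay class `{g : ∀ a, e^{a⟨x⟩} g ∈ L²}`; the weighted Caccioppoli inequality propagates it to `∂_p ∂_w f`; strong induction
on `|w|`.  Ingredients proved here: `∂_p∂_q = ∂_q∂_p` and `∂_p Δ = Δ ∂_p` on smooth functions, the commutator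
`𝔥(∂_p g) = ∂_p(𝔥 g) − (∂_p V) g`, the remainder structure (`exists_remainder_foldr_pderiv`).

All proved; no definitions, no named facts.

## References
* [Agmon1982] S. Agmon, *Lectures on Exponential Decay…*, Princeton Math. Notes 29 (1982), Thm. 1.5, Cor. 4.5.
* [GilbargTrudinger2001] D. Gilbarg, N. Trudinger, *Elliptic PDE of Second Order*, §8.3–8.4 (differentiating the equation).
-/

noncomputable section

open MeasureTheory Filter Topology Function Metric
open scoped BigOperators ContDiff

namespace Literature.Analysis.OperatorTheory.YMMatrixModel

/-! ### 1. Calculus of `∂_p` on smooth functions: commutation with `∂_q`, with `Δ` and with `𝔥` -/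

section Calculus

variable {g h : ZM → ℝ}

/-- `∂_p` of a smooth function is smooth. [cite: GilbargTrudinger2001, §8.3] -/
theorem contDiff_pderiv_of_infty (hg : ContDiff ℝ ∞ g) (p : Fin 3 × Fin 3) : ContDiff ℝ ∞ (pderiv p g) :=
  (hg.fderiv_right (m := ∞) (by simp)).clm_apply contDiff_const

/-- Iterated partial derivatives of a smooth function are smooth. [cite: GilbargTrudinger2001, §8.3] -/
theorem contDiff_foldr_pderiv (hg : ContDiff ℝ ∞ g) (w : List (Fin 3 × Fin 3)) : ContDiff ℝ ∞ (w.foldr pderiv g) := by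
  induction w with
  | nil => exact hg
  | cons p v ih => exact contDiff_pderiv_of_infty ih p

/-- A smooth function is `C²`. [cite: GilbargTrudinger2001, §8.3] -/
theorem contDiff_two_of_infty (hg : ContDiff ℝ ∞ g) : ContDiff ℝ 2 g := contDiff_infty.1 hg 2

/-- **Schwarz**: `∂_p∂_q g = ∂_q∂_p g` for `g ∈ C²`. [cite: GilbargTrudinger2001, §8.3] -/
theorem pderiv_pderiv_comm (hg : ContDiff ℝ 2 g) (p q : Fin 3 × Fin 3) (x : ZM) :
    pderiv p (pderiv q g) x = pderiv q (pderiv p g) x := by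
  have hd : DifferentiableAt ℝ (fderiv ℝ g) x :=
    ((hg.fderiv_right (m := 1) (by norm_num)).differentiable (by norm_num)) x
  have key : ∀ r s : Fin 3 × Fin 3, pderiv r (pderiv s g) x = fderiv ℝ (fderiv ℝ g) x (unitDir r) (unitDir s) := by
    intro r s
    have e : pderiv s g = fun y => fderiv ℝ g y (unitDir s) := rfl
    rw [pderiv, e, fderiv_clm_apply hd (differentiableAt_const _)]
    simp
  rw [key, key]
  exact (hg.contDiffAt.isSymmSndFDerivAt (by simp)).eq _ _

/-- `∂_p` of a finite sum of differentiable functions. [cite: GilbargTrudinger2001, §8.3] -/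
theorem pderiv_finset_sum {ι : Type*} (s : Finset ι) {A : ι → ZM → ℝ} (hA : ∀ i, Differentiable ℝ (A i))
    (p : Fin 3 × Fin 3) (x : ZM) :
    pderiv p (fun y => ∑ i ∈ s, A i y) x = ∑ i ∈ s, pderiv p (A i) x := by
  have h : HasFDerivAt (fun y => ∑ i ∈ s, A i y) (∑ i ∈ s, fderiv ℝ (A i) x) x :=
    HasFDerivAt.fun_sum fun i _ => (hA i x).hasFDerivAt
  rw [pderiv, h.fderiv, FunLike.coe_sum, Finset.sum_apply]
  rfl

/-- `∂_p (c g) = c ∂_p g` for a constant `c`. [cite: GilbargTrudinger2001, §8.3] -/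
theorem pderiv_const_mul (hg : Differentiable ℝ g) (c : ℝ) (p : Fin 3 × Fin 3) (x : ZM) :
    pderiv p (fun y => c * g y) x = c * pderiv p g x := by
  have := pderiv_smul hg c p x
  simpa [Pi.smul_def, smul_eq_mul] using this

/-- **`∂_p Δ g = Δ ∂_p g`** for smooth `g`. [cite: GilbargTrudinger2001, §8.3] -/
theorem pderiv_laplacian (hg : ContDiff ℝ ∞ g) (p : Fin 3 × Fin 3) (x : ZM) :
    pderiv p (laplacian g) x = laplacian (pderiv p g) x := by
  have e : laplacian g = fun y => ∑ q, pderiv q (pderiv q g) y := funext (laplacian_def g)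
  rw [e, laplacian_def, pderiv_finset_sum]
  · refine Finset.sum_congr rfl fun q _ => ?_
    -- `∂_p ∂_q ∂_q g = ∂_q ∂_p ∂_q g = ∂_q ∂_q ∂_p g`
    have h1 : ContDiff ℝ 2 (pderiv q g) := contDiff_two_of_infty (contDiff_pderiv_of_infty hg q)
    rw [pderiv_pderiv_comm h1 p q x]
    have h2 : pderiv p (pderiv q g) = pderiv q (pderiv p g) := funext fun y => pderiv_pderiv_comm (contDiff_two_of_infty hg) p q y
    rw [h2]
  · intro q
    exact ((contDiff_pderiv_of_infty (contDiff_pderiv_of_infty hg q) q).differentiable (by simp))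

end Calculus

/-! ### 2. Temperate growth: the potential and its derivatives are smooth with polynomial bounds -/

section Temperate

/-- Coordinates have temperate growth. [cite: GilbargTrudinger2001, §8.3] -/
theorem hasTemperateGrowth_coord (p : Fin 3 × Fin 3) : (fun x : ZM => x p).HasTemperateGrowth :=
  (EuclideanSpace.proj p : ZM →L[ℝ] ℝ).hasTemperateGrowth

/-- **Lüscher's potential has temperate growth** (a quartic polynomial in the coordinates).
[cite: SimonB1983DiscreteSpectrum, eq. (3) p. 211] -/
theorem hasTemperateGrowth_luscherPotential : luscherPotential.HasTemperateGrowth := by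
  have hc := hasTemperateGrowth_coord
  unfold luscherPotential
  simp only [cross_apply, colourVec, dotProduct, Fin.sum_univ_three, Matrix.cons_val_zero, Matrix.cons_val_one,
    Matrix.cons_val_two, Matrix.head_cons, Matrix.tail_cons]
  fun_prop

/-- Temperate growth is preserved by `x ↦ Dc(x) v`, in particular by `∂_p`. [cite: GilbargTrudinger2001, §8.3] -/
theorem hasTemperateGrowth_pderiv {c : ZM → ℝ} (hc : c.HasTemperateGrowth) (p : Fin 3 × Fin 3) :
    (pderiv p c).HasTemperateGrowth := by
  have h1 : (fderiv ℝ c).HasTemperateGrowth := by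
    refine ⟨hc.1.fderiv_right (m := ∞) (by simp), fun n => ?_⟩
    obtain ⟨k, C, h⟩ := hc.2 (n + 1)
    exact ⟨k, C, fun x => by rw [norm_iteratedFDeriv_fderiv]; exact h x⟩
  exact (ContinuousLinearMap.apply ℝ ℝ (unitDir p)).hasTemperateGrowth.comp h1

/-- The order-zero bound of a function of temperate growth: `|c x| ≤ C (1 + ‖x‖)^k`. [cite: GilbargTrudinger2001, §8.3] -/
theorem exists_abs_le_of_hasTemperateGrowth {c : ZM → ℝ} (hc : c.HasTemperateGrowth) :
    ∃ (k : ℕ) (C : ℝ), 0 ≤ C ∧ ∀ x, |c x| ≤ C * (1 + ‖x‖) ^ k := by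
  obtain ⟨k, C, h⟩ := hc.2 0
  have h' : ∀ x, |c x| ≤ C * (1 + ‖x‖) ^ k := fun x => by
    have := h x; rwa [norm_iteratedFDeriv_zero, Real.norm_eq_abs] at this
  refine ⟨k, max C 0, le_max_right _ _, fun x => (h' x).trans ?_⟩
  exact mul_le_mul_of_nonneg_right (le_max_left _ _) (by positivity)

/-- **The commutator of `𝔥` with `∂_p`**: `𝔥(∂_p g) = ∂_p(𝔥 g) − (∂_p V) g` for smooth `g`. [cite: Agmon1982, Cor. 4.5] -/
theorem hApply_pderiv {g : ZM → ℝ} (hg : ContDiff ℝ ∞ g) (p : Fin 3 × Fin 3) (x : ZM) :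
    hApply (pderiv p g) x = pderiv p (hApply g) x - pderiv p luscherPotential x * g x := by
  have hgd : Differentiable ℝ g := hg.differentiable (by simp)
  have hVd : Differentiable ℝ luscherPotential := (contDiff_luscherPotential (n := 1)).differentiable one_ne_zero
  have hLd : Differentiable ℝ (laplacian g) := by
    have e : laplacian g = fun y => ∑ q, pderiv q (pderiv q g) y := funext (laplacian_def g)
    rw [e]
    exact Differentiable.fun_sum fun q _ =>
      (contDiff_pderiv_of_infty (contDiff_pderiv_of_infty hg q) q).differentiable (by simp)
  have e : hApply g = (fun y => -(1 / 2 : ℝ) * laplacian g y) + (luscherPotential * g) := by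
    funext y; rw [hApply_def]; rfl
  rw [e, pderiv_add (hLd.const_mul _) (hVd.mul hgd), hApply_def, pderiv_const_mul hLd, pderiv_laplacian hg,
    pderiv_mul hVd hgd]
  ring

end Temperate

/-! ### 3. The decay class `∀ a ≥ 0, e^{a⟨x⟩} g ∈ L²` is a module over functions of temperate growth -/

section DecayClass

variable {g h c : ZM → ℝ}

/-- `(1 + ‖x‖)^k ≤ e^{k⟨x⟩}`. [cite: Agmon1982, Cor. 4.5] -/
theorem one_add_norm_pow_le_exp (k : ℕ) (x : ZM) :
    (1 + ‖x‖) ^ k ≤ Real.exp ((k : ℝ) * Real.sqrt (1 + ‖x‖ ^ 2)) := by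
  have h1 : 1 + ‖x‖ ≤ Real.exp (Real.sqrt (1 + ‖x‖ ^ 2)) := by
    have := Real.add_one_le_exp (Real.sqrt (1 + ‖x‖ ^ 2))
    have := norm_le_bracket x
    linarith
  calc (1 + ‖x‖) ^ k ≤ (Real.exp (Real.sqrt (1 + ‖x‖ ^ 2))) ^ k :=
        pow_le_pow_left₀ (by positivity) h1 k
    _ = Real.exp ((k : ℝ) * Real.sqrt (1 + ‖x‖ ^ 2)) := by rw [← Real.exp_nat_mul]

/-- **Temperate factors preserve the decay class**: if `e^{a⟨x⟩} g ∈ L²` for all `a ≥ 0` and `c` has temperate growth then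
`e^{a⟨x⟩} c g ∈ L²` for all `a ≥ 0`. [cite: Agmon1982, Cor. 4.5] -/
theorem decay_temperate_mul (hg : Continuous g) (hc : c.HasTemperateGrowth)
    (hW : ∀ a : ℝ, 0 ≤ a → Integrable fun x : ZM => Real.exp (a * Real.sqrt (1 + ‖x‖ ^ 2)) ^ 2 * g x ^ 2) :
    ∀ a : ℝ, 0 ≤ a → Integrable fun x : ZM => Real.exp (a * Real.sqrt (1 + ‖x‖ ^ 2)) ^ 2 * (c x * g x) ^ 2 := by
  intro a ha
  obtain ⟨k, C, hC0, hC⟩ := exists_abs_le_of_hasTemperateGrowth hc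
  have hI := (hW (a + k) (by positivity)).const_mul (C ^ 2)
  have hcc : Continuous c := hc.1.continuous
  refine hI.mono' ?_ (Eventually.of_forall fun x => ?_)
  · exact ((((contDiff_weight (φ := fun t => a * t) (contDiff_const.mul contDiff_id)).continuous.pow 2).mul
      ((hcc.mul hg).pow 2))).aestronglyMeasurable
  · rw [Real.norm_of_nonneg (by positivity)]
    have h1 : c x ^ 2 ≤ C ^ 2 * Real.exp ((k : ℝ) * Real.sqrt (1 + ‖x‖ ^ 2)) ^ 2 := by
      have h2 : |c x| ≤ C * Real.exp ((k : ℝ) * Real.sqrt (1 + ‖x‖ ^ 2)) :=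
        (hC x).trans (mul_le_mul_of_nonneg_left (one_add_norm_pow_le_exp k x) hC0)
      have h3 : 0 ≤ C * Real.exp ((k : ℝ) * Real.sqrt (1 + ‖x‖ ^ 2)) := by positivity
      calc c x ^ 2 = |c x| ^ 2 := (sq_abs _).symm
        _ ≤ (C * Real.exp ((k : ℝ) * Real.sqrt (1 + ‖x‖ ^ 2))) ^ 2 := pow_le_pow_left₀ (abs_nonneg _) h2 2
        _ = C ^ 2 * Real.exp ((k : ℝ) * Real.sqrt (1 + ‖x‖ ^ 2)) ^ 2 := by ring
    have hexp : Real.exp (a * Real.sqrt (1 + ‖x‖ ^ 2)) ^ 2 * Real.exp ((k : ℝ) * Real.sqrt (1 + ‖x‖ ^ 2)) ^ 2 =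
        Real.exp ((a + k) * Real.sqrt (1 + ‖x‖ ^ 2)) ^ 2 := by
      rw [← mul_pow, ← Real.exp_add]; ring_nf
    have h0 : 0 ≤ Real.exp (a * Real.sqrt (1 + ‖x‖ ^ 2)) ^ 2 * g x ^ 2 := by positivity
    calc Real.exp (a * Real.sqrt (1 + ‖x‖ ^ 2)) ^ 2 * (c x * g x) ^ 2
        = c x ^ 2 * (Real.exp (a * Real.sqrt (1 + ‖x‖ ^ 2)) ^ 2 * g x ^ 2) := by ring
      _ ≤ (C ^ 2 * Real.exp ((k : ℝ) * Real.sqrt (1 + ‖x‖ ^ 2)) ^ 2) * (Real.exp (a * Real.sqrt (1 + ‖x‖ ^ 2)) ^ 2 * g x ^ 2) :=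
          mul_le_mul_of_nonneg_right h1 h0
      _ = C ^ 2 * (Real.exp ((a + k) * Real.sqrt (1 + ‖x‖ ^ 2)) ^ 2 * g x ^ 2) := by rw [← hexp]; ring

/-- The decay class is closed under addition. [cite: Agmon1982, Cor. 4.5] -/
theorem decay_add (hg : Continuous g) (hh : Continuous h)
    (hWg : ∀ a : ℝ, 0 ≤ a → Integrable fun x : ZM => Real.exp (a * Real.sqrt (1 + ‖x‖ ^ 2)) ^ 2 * g x ^ 2)
    (hWh : ∀ a : ℝ, 0 ≤ a → Integrable fun x : ZM => Real.exp (a * Real.sqrt (1 + ‖x‖ ^ 2)) ^ 2 * h x ^ 2) :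
    ∀ a : ℝ, 0 ≤ a → Integrable fun x : ZM => Real.exp (a * Real.sqrt (1 + ‖x‖ ^ 2)) ^ 2 * (g x + h x) ^ 2 := by
  intro a ha
  have hI := ((hWg a ha).add (hWh a ha)).const_mul 2
  refine hI.mono' ?_ (Eventually.of_forall fun x => ?_)
  · exact ((((contDiff_weight (φ := fun t => a * t) (contDiff_const.mul contDiff_id)).continuous.pow 2).mul
      ((hg.add hh).pow 2))).aestronglyMeasurable
  · rw [Real.norm_of_nonneg (by positivity)]
    have h0 : 0 ≤ Real.exp (a * Real.sqrt (1 + ‖x‖ ^ 2)) ^ 2 := sq_nonneg _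
    simp only [Pi.add_apply]
    nlinarith [sq_nonneg (g x - h x), mul_nonneg h0 (sq_nonneg (g x - h x))]

/-- The decay class is closed under finite sums. [cite: Agmon1982, Cor. 4.5] -/
theorem decay_finset_sum {ι : Type*} (s : Finset ι) {G : ι → ZM → ℝ} (hG : ∀ i, Continuous (G i))
    (hW : ∀ i, ∀ a : ℝ, 0 ≤ a → Integrable fun x : ZM => Real.exp (a * Real.sqrt (1 + ‖x‖ ^ 2)) ^ 2 * G i x ^ 2) :
    ∀ a : ℝ, 0 ≤ a → Integrable fun x : ZM => Real.exp (a * Real.sqrt (1 + ‖x‖ ^ 2)) ^ 2 * (∑ i ∈ s, G i x) ^ 2 := by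
  classical
  induction s using Finset.induction_on with
  | empty => intro a ha; simp
  | insert j s hj ih =>
    intro a ha
    have hsum : Continuous fun x => ∑ i ∈ s, G i x := continuous_finsetSum _ fun i _ => hG i
    have := decay_add (hG j) hsum (hW j) ih a ha
    refine this.congr (Eventually.of_forall fun x => ?_)
    simp [Finset.sum_insert hj]

end DecayClass

/-! ### 4. Differentiating the equation: remainders and the decay of all derivatives -/

section Induction

variable {f : ZM → ℝ} {E : ℝ}

/-- **Remainder structure.**  For a smooth solution of `𝔥f = Ef` and every coordinate word `w`,
`𝔥(∂_w f) = E ∂_w f + Σ_i c_i ∂_{u_i} f` with finitely many coefficients `c_i` of temperate growth (derivatives of `V`) and words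
`u_i` strictly shorter than `w`. [cite: Agmon1982, Cor. 4.5] [cite: GilbargTrudinger2001, §8.3] -/
theorem exists_remainder_foldr_pderiv (hf : ContDiff ℝ ∞ f) (heq : ∀ x, hApply f x = E * f x) (w : List (Fin 3 × Fin 3)) :
    ∃ (ι : Type) (_ : Fintype ι) (c : ι → ZM → ℝ) (u : ι → List (Fin 3 × Fin 3)),
      (∀ i, (c i).HasTemperateGrowth) ∧ (∀ i, (u i).length < w.length) ∧
        ∀ x, hApply (w.foldr pderiv f) x = E * (w.foldr pderiv f) x + ∑ i, c i x * ((u i).foldr pderiv f) x := by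
  induction w with
  | nil => exact ⟨Empty, inferInstance, Empty.elim, Empty.elim, fun i => i.elim, fun i => i.elim, fun x => by simp [heq x]⟩
  | cons p v ih =>
    obtain ⟨ι, _, c, u, hc, hu, hid⟩ := ih
    set g : ZM → ℝ := v.foldr pderiv f with hg_def
    have hg : ContDiff ℝ ∞ g := contDiff_foldr_pderiv hf v
    -- the new index set: old terms differentiated in the coefficient, old terms differentiated in `f`, and the commutator term
    refine ⟨(ι ⊕ ι) ⊕ Unit, inferInstance,
      Sum.elim (Sum.elim (fun i => pderiv p (c i)) c) (fun _ x => -pderiv p luscherPotential x),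
      Sum.elim (Sum.elim u (fun i => p :: u i)) (fun _ => v), ?_, ?_, fun x => ?_⟩
    · rintro ((i | i) | ⟨⟩)
      · exact hasTemperateGrowth_pderiv (hc i) p
      · exact hc i
      · exact (hasTemperateGrowth_pderiv hasTemperateGrowth_luscherPotential p).neg
    · rintro ((i | i) | ⟨⟩)
      · simpa using Nat.lt_succ_of_lt (hu i)
      · simpa using hu i
      · simp
    · -- `𝔥(∂_p g) = ∂_p(𝔥 g) − (∂_p V) g`, and `𝔥 g = E g + Σ c_i ∂_{u_i} f` is differentiated termwise
      show hApply (pderiv p g) x = E * pderiv p g x + _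
      have hgd : Differentiable ℝ g := hg.differentiable (by simp)
      have hud : ∀ i, Differentiable ℝ ((u i).foldr pderiv f) := fun i =>
        (contDiff_foldr_pderiv hf (u i)).differentiable (by simp)
      have hcd : ∀ i, Differentiable ℝ (c i) := fun i => (hc i).1.differentiable (by simp)
      have e : hApply g = (fun y => E * g y) + fun y => ∑ i, c i y * ((u i).foldr pderiv f) y :=
        funext fun y => by rw [Pi.add_apply, hid y]
      have hsumd : Differentiable ℝ fun y => ∑ i, c i y * ((u i).foldr pderiv f) y :=
        Differentiable.fun_sum fun i _ => (hcd i).mul (hud i)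
      rw [hApply_pderiv hg, e, pderiv_add (hgd.const_mul E) hsumd,
        pderiv_const_mul hgd, pderiv_finset_sum _ (A := fun i y => c i y * ((u i).foldr pderiv f) y) (fun i => (hcd i).mul (hud i))]
      simp only [Fintype.sum_sum_type, Finset.univ_unique, Finset.sum_singleton, Sum.elim_inl, Sum.elim_inr,
        List.foldr_cons]
      have hterm : ∀ i, pderiv p (c i * (u i).foldr pderiv f) x =
          pderiv p (c i) x * ((u i).foldr pderiv f) x + c i x * pderiv p ((u i).foldr pderiv f) x := fun i =>
        pderiv_mul (hcd i) (hud i) p x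
      have hterm' : ∀ i, pderiv p (fun y => c i y * ((u i).foldr pderiv f) y) x =
          pderiv p (c i) x * ((u i).foldr pderiv f) x + c i x * pderiv p ((u i).foldr pderiv f) x := fun i => hterm i
      simp only [hterm', Finset.sum_add_distrib]
      ring

/-- ★★ **Exponential `L²` decay of all derivatives of an eigenfunction.**  For a smooth `f ∈ L²(ℝ⁹)` with `𝔥f = Ef` pointwise, every
iterated coordinate derivative `∂_w f` satisfies `∫ e^{2a⟨x⟩}(∂_w f)² < ∞` for every `a ≥ 0`.
[cite: Agmon1982, Cor. 4.5] [cite: GilbargTrudinger2001, §8.3] -/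
theorem integrable_exp_sq_mul_foldr_pderiv_sq (hf : ContDiff ℝ ∞ f) (hf2 : Integrable fun x => f x ^ 2)
    (heq : ∀ x, hApply f x = E * f x) (w : List (Fin 3 × Fin 3)) {a : ℝ} (ha : 0 ≤ a) :
    Integrable fun x : ZM => Real.exp (a * Real.sqrt (1 + ‖x‖ ^ 2)) ^ 2 * (w.foldr pderiv f) x ^ 2 := by
  -- strong induction on the length of the word
  suffices H : ∀ n : ℕ, ∀ w : List (Fin 3 × Fin 3), w.length = n →
      ∀ a : ℝ, 0 ≤ a → Integrable fun x : ZM => Real.exp (a * Real.sqrt (1 + ‖x‖ ^ 2)) ^ 2 * (w.foldr pderiv f) x ^ 2 from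
    H w.length w rfl a ha
  intro n
  induction n using Nat.strong_induction_on with
  | _ n ih =>
    intro w hw a ha
    match w, hw with
    | [], _ => simpa using integrable_exp_bracket_sq_mul_sq (contDiff_two_of_infty hf) hf2 heq ha
    | p :: v, hw =>
      have hvn : v.length < n := by rw [← hw]; simp
      set g : ZM → ℝ := v.foldr pderiv f with hg_def
      have hg : ContDiff ℝ ∞ g := contDiff_foldr_pderiv hf v
      obtain ⟨ι, _, c, u, hc, hu, hid⟩ := exists_remainder_foldr_pderiv hf heq v
      set r : ZM → ℝ := fun x => ∑ i, c i x * ((u i).foldr pderiv f) x with hr_def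
      have hrc : Continuous r := continuous_finsetSum _ fun i _ =>
        (hc i).1.continuous.mul (contDiff_foldr_pderiv hf (u i)).continuous
      have hr : ∀ x, hApply g x = E * g x + r x := hid
      -- decay of `g` and of `r`
      have hWg : ∀ b : ℝ, 0 ≤ b → Integrable fun x : ZM => Real.exp (b * Real.sqrt (1 + ‖x‖ ^ 2)) ^ 2 * g x ^ 2 :=
        fun b hb => ih v.length hvn v rfl b hb
      have hWr : ∀ b : ℝ, 0 ≤ b → Integrable fun x : ZM => Real.exp (b * Real.sqrt (1 + ‖x‖ ^ 2)) ^ 2 * r x ^ 2 :=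
        decay_finset_sum Finset.univ (fun i => (hc i).1.continuous.mul (contDiff_foldr_pderiv hf (u i)).continuous)
          fun i => decay_temperate_mul (contDiff_foldr_pderiv hf (u i)).continuous (hc i)
            fun b hb => ih (u i).length ((hu i).trans hvn) (u i) rfl b hb
      -- propagate with the linear weight `φ(t) = a t`
      have hφ : ContDiff ℝ 2 (fun t : ℝ => a * t) := contDiff_const.mul contDiff_id
      have hφL : ∀ t : ℝ, |deriv (fun t : ℝ => a * t) t| ≤ a := fun t => by
        rw [show (fun t : ℝ => a * t) = fun t => a * id t from rfl, deriv_const_mul a differentiableAt_id, deriv_id, mul_one,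
          abs_of_nonneg ha]
      have := integrable_weight_sq_mul_pderiv_sq (contDiff_two_of_infty hg) hrc hr hφ hφL (hWg a ha) (hWr a ha) p
      simpa [List.foldr_cons] using this

end Induction

end Literature.Analysis.OperatorTheory.YMMatrixModel

end
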